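import Mathlib.Algebra.Order.BigOperators.Group.Finset
import Mathlib.Algebra.BigOperators.Ring.Finset
import Mathlib.Data.Fintype.BigOperators
import Mathlib.Data.Real.Basic
import Mathlib.Data.Fintype.Prod
import Mathlib.Order.UpperLower.Basic
import Mathlib.Tactic.Linarith
import Mathlib.Tactic.Ring
import Mathlib.Tactic.Positivity
import HarnessLib
import HarnessLib.Audit

/-!
# `NoHeavyLowerTail` (crux stmt-CriticalPhenomena-4575), Sahi programme P4: sections of up-sets of a product `B × Q`
# and Harris' inequality for the product of two Harris posets

Support file (cell `prim-l12`, seat P4, generation 13; `--supports stmt-CriticalPhenomena-4575`).  No named facts, no sorries;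
standard axioms; def-free.

Bookkeeping for subsets `X ⊆ B × Q` of a product of finite posets: sums by `Q`-sections `{t | (b,t) ∈ X}` and by `B`-sections
`{b | (b,t) ∈ X}` (`sum_sectionsQ`, `sum_sectionsB`), sections of up-sets are up-sets, sections of intersections, and the
INTERCHANGE identity `Σ_{b,b'} ν_B(b)ν_B(b')·w(S_b ∩ S'_{b'}) = Σ_t w(t)·ν_B{b | (b,t) ∈ S}·ν_B{b' | (b',t) ∈ S'}`
(`sum_sections_interchange`).  Consequence: **Harris' inequality for the product weight** `ν(b,t) = ν_B(b)ν_Q(t)` of two finite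
posets with nonnegative weights each satisfying Harris' inequality for up-sets (`harris_prod`: Harris on `Q` for every CROSS pair
of `Q`-sections, interchange, Harris on `B` for the `B`-sections).  Used by `…SahiE3CertCylinder` (cylinder extension of a flow
certificate) and by the block OR-step programme (HOME memo prim-l12/FROM-prim-l12-p4-gen13-BLOCK-OR-STEP.md).
-/

namespace Summit.CriticalPhenomena.PercolationContinuityZ3.Theorems.SahiE3ProductSections

open Finset
open scoped BigOperators

variable {B Q : Type*} [Fintype B] [DecidableEq B] [PartialOrder B] [Fintype Q] [DecidableEq Q] [PartialOrder Q]

/-! ### Sections of a subset of `B × Q` -/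

omit [PartialOrder B] [PartialOrder Q] in
/-- Sum over a subset of `B × Q` by `Q`-sections. [folklore] -/
theorem sum_sectionsQ (X : Finset (B × Q)) (f : B × Q → ℝ) :
    ∑ x ∈ X, f x = ∑ b, ∑ t ∈ univ.filter (fun t => (b, t) ∈ X), f (b, t) := by
  have h1 : ∑ x ∈ X, f x = ∑ x, (if x ∈ X then f x else 0) := by
    rw [← Finset.sum_filter]; congr 1; ext x; simp
  rw [h1, Fintype.sum_prod_type]
  refine Finset.sum_congr rfl fun b _ => ?_
  rw [Finset.sum_filter]

omit [PartialOrder B] [PartialOrder Q] in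
/-- Sum over a subset of `B × Q` by `B`-sections. [folklore] -/
theorem sum_sectionsB (X : Finset (B × Q)) (f : B × Q → ℝ) :
    ∑ x ∈ X, f x = ∑ t, ∑ b ∈ univ.filter (fun b => (b, t) ∈ X), f (b, t) := by
  have h1 : ∑ x ∈ X, f x = ∑ x, (if x ∈ X then f x else 0) := by
    rw [← Finset.sum_filter]; congr 1; ext x; simp
  rw [h1, Fintype.sum_prod_type, Finset.sum_comm]
  refine Finset.sum_congr rfl fun t _ => ?_
  rw [Finset.sum_filter]

omit [Fintype B] in
/-- `Q`-sections of an up-set are up-sets. [folklore] -/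
theorem isUpperSet_secQ {X : Finset (B × Q)} (hX : IsUpperSet (X : Set (B × Q))) (b : B) :
    IsUpperSet ((univ.filter fun t => (b, t) ∈ X : Finset Q) : Set Q) := by
  intro t t' htt' ht
  simp only [Finset.coe_filter, Finset.mem_univ, true_and, Set.mem_setOf_eq] at ht ⊢
  exact hX (Prod.mk_le_mk.2 ⟨le_rfl, htt'⟩) ht

omit [Fintype Q] in
/-- `B`-sections of an up-set are up-sets. [folklore] -/
theorem isUpperSet_secB {X : Finset (B × Q)} (hX : IsUpperSet (X : Set (B × Q))) (t : Q) :
    IsUpperSet ((univ.filter fun b => (b, t) ∈ X : Finset B) : Set B) := by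
  intro b b' hbb' hb
  simp only [Finset.coe_filter, Finset.mem_univ, true_and, Set.mem_setOf_eq] at hb ⊢
  exact hX (Prod.mk_le_mk.2 ⟨hbb', le_rfl⟩) hb

omit [PartialOrder B] [PartialOrder Q] [Fintype B] in
/-- `Q`-sections of an intersection. [folklore] -/
theorem secQ_inter (X Y : Finset (B × Q)) (b : B) :
    univ.filter (fun t => (b, t) ∈ X ∩ Y) = univ.filter (fun t => (b, t) ∈ X) ∩ univ.filter (fun t => (b, t) ∈ Y) := by
  ext t; simp

omit [PartialOrder B] [PartialOrder Q] [Fintype Q] in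
/-- `B`-sections of an intersection. [folklore] -/
theorem secB_inter (X Y : Finset (B × Q)) (t : Q) :
    univ.filter (fun b => (b, t) ∈ X ∩ Y) = univ.filter (fun b => (b, t) ∈ X) ∩ univ.filter (fun b => (b, t) ∈ Y) := by
  ext b; simp

omit [PartialOrder B] [PartialOrder Q] [DecidableEq B] [Fintype Q] [DecidableEq Q] in
/-- Pulling a scalar out of a double sum. [folklore] -/
theorem dsum_mul (c : ℝ) (F : B → B → ℝ) : ∑ b, ∑ b', c * F b b' = c * ∑ b, ∑ b', F b b' := by
  rw [Finset.mul_sum]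
  exact Finset.sum_congr rfl fun b _ => by rw [Finset.mul_sum]

omit [PartialOrder B] [PartialOrder Q] in
/-- **Interchange.**  `Σ_{b,b'} ν_B(b)ν_B(b')·w(S_b ∩ S'_{b'}) = Σ_t w(t)·ν_B{b | (b,t) ∈ S}·ν_B{b' | (b',t) ∈ S'}`. [folklore] -/
theorem sum_sections_interchange (νB : B → ℝ) (w : Q → ℝ) (S S' : Finset (B × Q)) :
    ∑ b, ∑ b', νB b * νB b' *
        ∑ t ∈ univ.filter (fun t => (b, t) ∈ S) ∩ univ.filter (fun t => (b', t) ∈ S'), w t =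
      ∑ t, w t * (∑ b ∈ univ.filter (fun b => (b, t) ∈ S), νB b) * ∑ b' ∈ univ.filter (fun b' => (b', t) ∈ S'), νB b' := by
  -- both sides equal the triple sum of `c b b' t := [ (b,t) ∈ S ] [ (b',t) ∈ S' ] ν_B(b) ν_B(b') w(t)`
  have lhs : ∀ b b', νB b * νB b' * ∑ t ∈ univ.filter (fun t => (b, t) ∈ S) ∩ univ.filter (fun t => (b', t) ∈ S'), w t =
      ∑ t, (if (b, t) ∈ S then νB b else 0) * (if (b', t) ∈ S' then νB b' else 0) * w t := by
    intro b b'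
    have hf : univ.filter (fun t => (b, t) ∈ S) ∩ univ.filter (fun t => (b', t) ∈ S') =
        univ.filter (fun t => (b, t) ∈ S ∧ (b', t) ∈ S') := by ext t; simp
    rw [hf]
    rw [Finset.sum_filter (p := fun t => (b, t) ∈ S ∧ (b', t) ∈ S') (f := w)]
    rw [Finset.mul_sum]
    refine Finset.sum_congr rfl fun t _ => ?_
    by_cases h1 : (b, t) ∈ S
    · by_cases h2 : (b', t) ∈ S'
      · simp [h1, h2, mul_comm, mul_left_comm]
      · simp [h1, h2]
    · by_cases h2 : (b', t) ∈ S'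
      · simp [h1, h2]
      · simp [h1, h2]
  have rhs : ∀ t, w t * (∑ b ∈ univ.filter (fun b => (b, t) ∈ S), νB b) * (∑ b' ∈ univ.filter (fun b' => (b', t) ∈ S'), νB b') =
      ∑ b, ∑ b', (if (b, t) ∈ S then νB b else 0) * (if (b', t) ∈ S' then νB b' else 0) * w t := by
    intro t
    rw [Finset.sum_filter (p := fun b => (b, t) ∈ S) (f := νB), Finset.sum_filter (p := fun b' => (b', t) ∈ S') (f := νB),
      mul_assoc, Finset.sum_mul_sum, Finset.mul_sum]
    refine Finset.sum_congr rfl fun b _ => ?_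
    rw [Finset.mul_sum]
    refine Finset.sum_congr rfl fun b' _ => ?_
    by_cases h1 : (b, t) ∈ S
    · by_cases h2 : (b', t) ∈ S'
      · simp [h1, h2, mul_comm, mul_left_comm]
      · simp [h1, h2]
    · by_cases h2 : (b', t) ∈ S'
      · simp [h1, h2]
      · simp [h1, h2]
  have e1 : ∑ b, ∑ b', νB b * νB b' * ∑ t ∈ univ.filter (fun t => (b, t) ∈ S) ∩ univ.filter (fun t => (b', t) ∈ S'), w t =
      ∑ b, ∑ b', ∑ t, (if (b, t) ∈ S then νB b else 0) * (if (b', t) ∈ S' then νB b' else 0) * w t :=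
    Finset.sum_congr rfl fun b _ => Finset.sum_congr rfl fun b' _ => lhs b b'
  have e2 : ∑ t, w t * (∑ b ∈ univ.filter (fun b => (b, t) ∈ S), νB b) * (∑ b' ∈ univ.filter (fun b' => (b', t) ∈ S'), νB b') =
      ∑ t, ∑ b, ∑ b', (if (b, t) ∈ S then νB b else 0) * (if (b', t) ∈ S' then νB b' else 0) * w t :=
    Finset.sum_congr rfl fun t _ => rhs t
  rw [e1, e2]
  calc (∑ b, ∑ b', ∑ t, (if (b, t) ∈ S then νB b else 0) * (if (b', t) ∈ S' then νB b' else 0) * w t)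
      = ∑ b, ∑ t, ∑ b', (if (b, t) ∈ S then νB b else 0) * (if (b', t) ∈ S' then νB b' else 0) * w t :=
        Finset.sum_congr rfl fun b _ => Finset.sum_comm
    _ = ∑ t, ∑ b, ∑ b', (if (b, t) ∈ S then νB b else 0) * (if (b', t) ∈ S' then νB b' else 0) * w t :=
        Finset.sum_comm

/-! ### Harris for the product weight -/

/-- **Harris' inequality for a product of two Harris posets** (weights `ν_B, ν_Q ≥ 0` on finite posets `B, Q`, each satisfying
Harris for up-sets; product weight on `B × Q`). [folklore] -/
theorem harris_prod {νB : B → ℝ} {νQ : Q → ℝ} (hνB : ∀ b, 0 ≤ νB b) (hνQ : ∀ t, 0 ≤ νQ t)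
    (hHB : ∀ S S' : Finset B, IsUpperSet (S : Set B) → IsUpperSet (S' : Set B) →
      (∑ t ∈ S, νB t) * (∑ t ∈ S', νB t) ≤ (∑ t, νB t) * ∑ t ∈ S ∩ S', νB t)
    (hHQ : ∀ S S' : Finset Q, IsUpperSet (S : Set Q) → IsUpperSet (S' : Set Q) →
      (∑ t ∈ S, νQ t) * (∑ t ∈ S', νQ t) ≤ (∑ t, νQ t) * ∑ t ∈ S ∩ S', νQ t)
    (ν : B × Q → ℝ) (hν : ∀ x, ν x = νB x.1 * νQ x.2)
    (S S' : Finset (B × Q)) (hS : IsUpperSet (S : Set (B × Q))) (hS' : IsUpperSet (S' : Set (B × Q))) :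
    (∑ x ∈ S, ν x) * (∑ x ∈ S', ν x) ≤ (∑ x, ν x) * ∑ x ∈ S ∩ S', ν x := by
  -- masses by Q-sections
  have eS : ∑ x ∈ S, ν x = ∑ b, νB b * ∑ t ∈ univ.filter (fun t => (b, t) ∈ S), νQ t := by
    rw [sum_sectionsQ]; refine Finset.sum_congr rfl fun b _ => ?_; rw [Finset.mul_sum]
    exact Finset.sum_congr rfl fun t _ => hν (b, t)
  have eS' : ∑ x ∈ S', ν x = ∑ b, νB b * ∑ t ∈ univ.filter (fun t => (b, t) ∈ S'), νQ t := by
    rw [sum_sectionsQ]; refine Finset.sum_congr rfl fun b _ => ?_; rw [Finset.mul_sum]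
    exact Finset.sum_congr rfl fun t _ => hν (b, t)
  have eZ : ∑ x, ν x = (∑ b, νB b) * ∑ t, νQ t := by
    rw [show (∑ x, ν x) = ∑ x : B × Q, νB x.1 * νQ x.2 from Finset.sum_congr rfl fun x _ => hν x,
      Finset.sum_mul_sum, ← Finset.univ_product_univ, Finset.sum_product]
  -- mass of the intersection by B-sections
  have eI : ∑ x ∈ S ∩ S', ν x = ∑ t, νQ t * ∑ b ∈ univ.filter (fun b => (b, t) ∈ S ∩ S'), νB b := by
    rw [sum_sectionsB]; refine Finset.sum_congr rfl fun t _ => ?_; rw [Finset.mul_sum]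
    exact Finset.sum_congr rfl fun b _ => by rw [hν]; ring
  -- step 1: Harris on Q for every pair of sections
  have step1 : (∑ x ∈ S, ν x) * (∑ x ∈ S', ν x) ≤
      (∑ t, νQ t) * ∑ b, ∑ b', νB b * νB b' *
        ∑ t ∈ univ.filter (fun t => (b, t) ∈ S) ∩ univ.filter (fun t => (b', t) ∈ S'), νQ t := by
    have key : ∀ b b', νB b * (∑ t ∈ univ.filter (fun t => (b, t) ∈ S), νQ t) *
        (νB b' * ∑ t ∈ univ.filter (fun t => (b', t) ∈ S'), νQ t) ≤
        (∑ t, νQ t) * (νB b * νB b' *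
          ∑ t ∈ univ.filter (fun t => (b, t) ∈ S) ∩ univ.filter (fun t => (b', t) ∈ S'), νQ t) := by
      intro b b'
      have h := hHQ _ _ (isUpperSet_secQ hS b) (isUpperSet_secQ hS' b')
      have hb : 0 ≤ νB b * νB b' := mul_nonneg (hνB b) (hνB b')
      have h2 := mul_le_mul_of_nonneg_left h hb
      have e : νB b * (∑ t ∈ univ.filter (fun t => (b, t) ∈ S), νQ t) *
          (νB b' * ∑ t ∈ univ.filter (fun t => (b', t) ∈ S'), νQ t) =
          (νB b * νB b') * ((∑ t ∈ univ.filter (fun t => (b, t) ∈ S), νQ t) *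
            ∑ t ∈ univ.filter (fun t => (b', t) ∈ S'), νQ t) := by ring
      rw [e]
      linarith
    rw [eS, eS', Finset.sum_mul_sum, ← dsum_mul]
    exact Finset.sum_le_sum fun b _ => Finset.sum_le_sum fun b' _ => key b b'
  -- step 2: interchange and Harris on B for every `t`
  rw [sum_sections_interchange] at step1
  have step2 : ∑ t, νQ t * (∑ b ∈ univ.filter (fun b => (b, t) ∈ S), νB b) *
        (∑ b' ∈ univ.filter (fun b' => (b', t) ∈ S'), νB b')
      ≤ ∑ t, νQ t * ((∑ b, νB b) * ∑ b ∈ univ.filter (fun b => (b, t) ∈ S ∩ S'), νB b) := by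
    refine Finset.sum_le_sum fun t _ => ?_
    rw [mul_assoc, secB_inter]
    exact mul_le_mul_of_nonneg_left (hHB _ _ (isUpperSet_secB hS t) (isUpperSet_secB hS' t)) (hνQ t)
  have e3 : ∑ t, νQ t * ((∑ b, νB b) * ∑ b ∈ univ.filter (fun b => (b, t) ∈ S ∩ S'), νB b) =
      (∑ b, νB b) * ∑ x ∈ S ∩ S', ν x := by
    rw [eI, Finset.mul_sum]
    exact Finset.sum_congr rfl fun t _ => by ring
  have hZQ : 0 ≤ ∑ t, νQ t := Finset.sum_nonneg fun t _ => hνQ t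
  calc (∑ x ∈ S, ν x) * (∑ x ∈ S', ν x)
      ≤ (∑ t, νQ t) * ∑ t, νQ t * (∑ b ∈ univ.filter (fun b => (b, t) ∈ S), νB b) *
          (∑ b' ∈ univ.filter (fun b' => (b', t) ∈ S'), νB b') := step1
    _ ≤ (∑ t, νQ t) * ∑ t, νQ t * ((∑ b, νB b) * ∑ b ∈ univ.filter (fun b => (b, t) ∈ S ∩ S'), νB b) :=
          mul_le_mul_of_nonneg_left step2 hZQ
    _ = (∑ x, ν x) * ∑ x ∈ S ∩ S', ν x := by rw [e3, eZ]; ring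

end Summit.CriticalPhenomena.PercolationContinuityZ3.Theorems.SahiE3ProductSections
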